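import Literature.NumberTheory.Transcendental.UnivExtChartLattice
import HarnessLib

/-!
# The theta functions of `E♮` in the chart at the origin of `E`

Topic: `Literature/NumberTheory/Transcendental`. Sequel to `UnivExtChartLattice.lean` (chart
coordinates `u = P₀/P₂`, `p = P₁/P₂`, `g = Z₂/P₂` of `E♮` near the fibre over `0 ∈ E`, with their
polynomial differential equations), plan item W4a of the unit
`provefact-Literature.NumberTheory.Transcendental.H-b596640137`. PROVED here: wherever
`P₂(z) ≠ 0`, the six theta functions of `E♮` (`UnivExtTheta.lean`) divided by the non-vanishing
coordinate `Θ_{inl 2} = P₂` are POLYNOMIALS in `u, p, g, t` with coefficients in `ℚ(g₂, g₃)`: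

* `P₀/P₂ = u`, `P₁/P₂ = p`, `P₂/P₂ = 1`;
* `Z₀/P₂ = gu - 2p²`, `Z₁/P₂ = gp - 1/2 - (g₂/2)pu - (g₃/2)u²`, `Z₂/P₂ = g`
  (`PeriodPair.univExtZ_div_univExtP_two`);
* hence `Θ_{inr 0}/P₂ = (t - g)u + 2p²`, `Θ_{inr 1}/P₂ = (t - g)p + 1/2 + (g₂/2)pu + (g₃/2)u²`,
  `Θ_{inr 2}/P₂ = t - g` (`PeriodPair.univExtTheta_div_univExtP_two`);
* and the chart relation (the Weierstrass equation divided by `℘′³`)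
  `u = 4p³ - g₂pu² - g₃u³` (`PeriodPair.latU_eq`).

Off the lattice these are the identities `ζ/℘′ = (ζ + 2℘²/℘′)/℘′ - 2℘²/℘′²`,
`℘ζ/℘′ = gp - 2℘³/℘′²` with `℘³/℘′² = 1/4 + (g₂/4)pu + (g₃/4)u²`; at the lattice points `σ = 0`
and both sides are computed from `P₂ = -2σ′³`, `Z₁ = σ′³`, `Z₀ = P₀ = P₁ = 0`. Together with the
chart equations of `UnivExtChartLattice.lean` and `∂_t(Θ/P₂) = (0,0,0,u,p,1)` this makes the
jets of forms in `Θ` along lines through points over `E_tors` polynomial (via `PolyODEJets.lean`).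

## References

* A. Baker, G. Wüstholz, *Logarithmic Forms and Diophantine Geometry*, CUP 2007, §6.7–6.8.
* E. T. Whittaker, G. N. Watson, *A Course of Modern Analysis*, §§20.2–20.4.
-/

noncomputable section

open Complex
open scoped PeriodPair

namespace Literature.NumberTheory.Transcendental

variable {L : PeriodPair}

/-- At a zero of `σ` (a lattice point) the blocks are `P = (0, 0, -2σ′³)`, `Z = (0, σ′³, -σ′²σ″)`.
[folklore] -/
theorem _root_.PeriodPair.univExtP_univExtZ_of_sigma_eq_zero {z : ℂ} (hσ : L.weierstrassSigma z = 0) :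
    L.univExtP 0 z = 0 ∧ L.univExtP 1 z = 0 ∧ L.univExtP 2 z = -2 * L.sigmaDeriv 1 z ^ 3 ∧
    L.univExtZ 0 z = 0 ∧ L.univExtZ 1 z = L.sigmaDeriv 1 z ^ 3 ∧
    L.univExtZ 2 z = -(L.sigmaDeriv 1 z ^ 2 * L.sigmaDeriv 2 z) := by
  have h0 : L.sigmaDeriv 0 z = 0 := by simpa using hσ
  simp only [PeriodPair.univExtP_zero, PeriodPair.univExtP_one, PeriodPair.univExtP_two,
    PeriodPair.univExtZ_zero, PeriodPair.univExtZ_one, PeriodPair.univExtZ_two, h0]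
  refine ⟨?_, ?_, ?_, ?_, ?_, ?_⟩ <;> ring

/-- **The `ζ`-companions in the chart at the origin**: wherever `P₂ ≠ 0`,
`Z₀/P₂ = gu - 2p²`, `Z₁/P₂ = gp - 1/2 - (g₂/2)pu - (g₃/2)u²`, `Z₂/P₂ = g`. [folklore] -/
theorem _root_.PeriodPair.univExtZ_div_univExtP_two {z : ℂ} (h2 : L.univExtP 2 z ≠ 0) :
    L.univExtZ 0 z / L.univExtP 2 z = L.latG z * L.latU z - 2 * L.latP z ^ 2 ∧
    L.univExtZ 1 z / L.univExtP 2 z =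
      L.latG z * L.latP z - 1 / 2 - L.g₂ / 2 * L.latP z * L.latU z - L.g₃ / 2 * L.latU z ^ 2 ∧
    L.univExtZ 2 z / L.univExtP 2 z = L.latG z := by
  by_cases hz : z ∈ L.lattice
  · -- at a lattice point: `σ = 0`, `u = p = 0`
    have hσ : L.weierstrassSigma z = 0 := (L.weierstrassSigma_eq_zero_iff_holds z).mpr hz
    obtain ⟨p0, p1, p2, z0, z1, -⟩ := PeriodPair.univExtP_univExtZ_of_sigma_eq_zero hσ
    have hs1 : L.sigmaDeriv 1 z ≠ 0 := by
      intro h; apply h2; rw [p2, h]; ring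
    have hu : L.latU z = 0 := by simp [PeriodPair.latU, p0]
    have hp : L.latP z = 0 := by simp [PeriodPair.latP, p1]
    refine ⟨?_, ?_, rfl⟩
    · rw [z0, zero_div, hu, hp]; ring
    · rw [z1, p2, hu, hp]
      have : L.sigmaDeriv 1 z ^ 3 ≠ 0 := pow_ne_zero _ hs1
      field_simp
      ring
  · -- off the lattice: explicit forms and the Weierstrass equation
    have h℘' := PeriodPair.derivWeierstrassP_ne_zero_of_univExtP_two hz h2
    have hσ : L.weierstrassSigma z ≠ 0 := L.weierstrassSigma_ne_zero hz
    obtain ⟨eu, ep, eg⟩ := PeriodPair.latU_latP_latG_eq hz h2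
    obtain ⟨-, -, p2⟩ := PeriodPair.univExtP_eq hz
    obtain ⟨z0, z1, -⟩ := PeriodPair.univExtZ_eq hz
    have hcurve := L.derivWeierstrassP_sq z hz
    refine ⟨?_, ?_, rfl⟩
    · rw [z0, p2, eu, ep, eg]
      field_simp
      ring
    · rw [z1, p2, eu, ep, eg]
      field_simp
      linear_combination hcurve

/-- **The theta functions of `E♮` in the chart at the origin**: wherever `P₂(z) ≠ 0`,
`Θ(z,t)/P₂(z) = (u, p, 1, (t - g)u + 2p², (t - g)p + 1/2 + (g₂/2)pu + (g₃/2)u², t - g)`.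
[folklore] -/
theorem _root_.PeriodPair.univExtTheta_div_univExtP_two {z : ℂ} (h2 : L.univExtP 2 z ≠ 0) (t : ℂ) :
    L.univExtTheta (Sum.inl 0) (z, t) / L.univExtP 2 z = L.latU z ∧
    L.univExtTheta (Sum.inl 1) (z, t) / L.univExtP 2 z = L.latP z ∧
    L.univExtTheta (Sum.inl 2) (z, t) / L.univExtP 2 z = 1 ∧
    L.univExtTheta (Sum.inr 0) (z, t) / L.univExtP 2 z =
      (t - L.latG z) * L.latU z + 2 * L.latP z ^ 2 ∧
    L.univExtTheta (Sum.inr 1) (z, t) / L.univExtP 2 z =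
      (t - L.latG z) * L.latP z + 1 / 2 + L.g₂ / 2 * L.latP z * L.latU z + L.g₃ / 2 * L.latU z ^ 2 ∧
    L.univExtTheta (Sum.inr 2) (z, t) / L.univExtP 2 z = t - L.latG z := by
  obtain ⟨q0, q1, q2⟩ := PeriodPair.univExtZ_div_univExtP_two h2
  simp only [PeriodPair.univExtTheta_inl, PeriodPair.univExtTheta_inr]
  refine ⟨rfl, rfl, div_self h2, ?_, ?_, ?_⟩
  · rw [sub_div, mul_div_assoc, q0, show L.univExtP 0 z / L.univExtP 2 z = L.latU z from rfl]
    ring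
  · rw [sub_div, mul_div_assoc, q1, show L.univExtP 1 z / L.univExtP 2 z = L.latP z from rfl]
    ring
  · rw [sub_div, mul_div_assoc, q2, div_self h2]
    ring

/-- **The chart relation** (Weierstrass equation divided by `℘′³`): wherever `P₂ ≠ 0`,
`u = 4p³ - g₂pu² - g₃u³`. [folklore] -/
theorem _root_.PeriodPair.latU_eq {z : ℂ} (h2 : L.univExtP 2 z ≠ 0) :
    L.latU z = 4 * L.latP z ^ 3 - L.g₂ * L.latP z * L.latU z ^ 2 - L.g₃ * L.latU z ^ 3 := by
  by_cases hz : z ∈ L.lattice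
  · obtain ⟨-, hu, hp, -⟩ : L.univExtP 2 z ≠ 0 ∧ L.latU z = 0 ∧ L.latP z = 0 ∧ True := by
      have hσ : L.weierstrassSigma z = 0 := (L.weierstrassSigma_eq_zero_iff_holds z).mpr hz
      obtain ⟨p0, p1, -, -, -, -⟩ := PeriodPair.univExtP_univExtZ_of_sigma_eq_zero hσ
      exact ⟨h2, by simp [PeriodPair.latU, p0], by simp [PeriodPair.latP, p1], trivial⟩
    rw [hu, hp]; ring
  · have h℘' := PeriodPair.derivWeierstrassP_ne_zero_of_univExtP_two hz h2
    obtain ⟨eu, ep, -⟩ := PeriodPair.latU_latP_latG_eq hz h2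
    have hcurve := L.derivWeierstrassP_sq z hz
    rw [eu, ep]
    field_simp
    linear_combination hcurve

/-- In the chart at the origin the `E♮`-theta functions are polynomials in `(u, p, g, t)`; in
particular at a lattice point `λ` (where `u = p = 0`, `g = η(λ)`):
`Θ(λ, t)/P₂(λ) = (0, 0, 1, 0, 1/2, t - η(λ))`. [folklore] -/
theorem _root_.PeriodPair.univExtTheta_div_univExtP_two_lattice (L : PeriodPair) (m n : ℤ) (t : ℂ) :
    L.univExtTheta (Sum.inr 1) (m * L.ω₁ + n * L.ω₂, t) / L.univExtP 2 (m * L.ω₁ + n * L.ω₂) = 1 / 2 ∧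
    L.univExtTheta (Sum.inr 2) (m * L.ω₁ + n * L.ω₂, t) / L.univExtP 2 (m * L.ω₁ + n * L.ω₂) =
      t - (m * L.η₁ + n * L.η₂) := by
  obtain ⟨h2, hu, hp, hg⟩ := L.latU_latP_latG_lattice m n
  obtain ⟨-, -, -, -, v1, v2⟩ := PeriodPair.univExtTheta_div_univExtP_two h2 t
  refine ⟨?_, ?_⟩
  · rw [v1, hu, hp]; ring
  · rw [v2, hg]

end Literature.NumberTheory.Transcendental

end
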